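import Literature.Barriers.QuantumFields.CenterSymmetryBreakingByQuarks
import Literature.MathematicalPhysics.QuantumFieldTheory.YangMillsOS
import HarnessLib

/-!
# `RobustYangMillsRG` — negative side, part B₁: at `β = 0` distinct `SU(3)` plaquettes are
# uncorrelated and centred (single-link centre twist)

Support lemmas for the disproof of the crux `RobustYangMillsRG` (stmt-QuantumFields-14958).
Under the product Haar probability measure on the links of the torus `(ℤ/L)^d`, `L > 1`
(Wilson's `SU(3)` theory at `β = 0` — the admissible junk weight `w ≡ 1` of the disproof):

* `integral_plaqTr_mul_eq_zero` — for every genuine plaquette `p` and every edge `e₀` of `p`,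
  `∫ tr U_p · Y dU = 0` for every `Y` invariant under the single-link centre twist
  `U_{e₀} ↦ ζ U_{e₀}`, `ζ = e^{2πi/3}·1 ∈ Z(SU(3))` (the twist preserves product Haar measure and
  multiplies `tr U_p` by `ω^{±1} ≠ 1`: the order-parameter mechanism
  `Literature.Barriers.QuantumFields.integral_eq_zero_of_covariant`);
* hence distinct plaquettes are UNCORRELATED and centred at `β = 0` — including torus-neighbours,
  so there are NO wrap-around terms — and the Wilson action densities
  `O_x = ∑_{i<j} Re tr U_{p_{ij}(x)}` at two distinct torus sites satisfy
  `∫ O_x O_y dU = 0` and `∫ O_x dU = 0` (`integral_siteAction_mul_eq_zero`,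
  `integral_siteAction_eq_zero`).
Part B₂ (`HaarCurvatureFactorisation`) turns this into the exact factorisation of the crux's
smeared curvature two-point function on real pairs `f · g ≡ 0`. [folklore]
-/

noncomputable section

namespace Summit.QuantumFields.QCD.Theorems.RobustYangMillsRG.Negative

open MeasureTheory Complex Finset
open Literature.MathematicalPhysics.QuantumFieldTheory Literature.MathematicalPhysics.QuantumLattice
open Literature.Barriers.QuantumFields

/-- The gauge group `SU(3)` of the crux. [folklore] -/
abbrev SU3 : Type := ↥(Matrix.specialUnitaryGroup (Fin 3) ℂ)

/-- The primitive cube root of unity `ω = e^{2πi/3}`. [folklore] -/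
def ω : ℂ := Complex.exp (2 * Real.pi * Complex.I / 3)

/-- `ω` is a primitive cube root of unity. [folklore] -/
theorem isPrimitiveRoot_ω : IsPrimitiveRoot ω 3 := by
  simpa [ω] using Complex.isPrimitiveRoot_exp 3 (by norm_num)

/-- `ω³ = 1`. [folklore] -/
theorem ω_pow_three : ω ^ 3 = 1 := isPrimitiveRoot_ω.pow_eq_one

/-- `ω ≠ 1`. [folklore] -/
theorem ω_ne_one : ω ≠ 1 := isPrimitiveRoot_ω.ne_one (by norm_num)

/-- `ω² ≠ 1`. [folklore] -/
theorem ω_sq_ne_one : ω ^ 2 ≠ 1 := isPrimitiveRoot_ω.pow_ne_one_of_pos_of_lt (by norm_num) (by norm_num)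

/-- The centre element `ζ = ω · 1 ∈ SU(3)`. [folklore] -/
def ζ : SU3 := scalarCenter 3 ω ω_pow_three (by norm_num)

/-- `ζ` is central in `SU(3)`. [folklore] -/
theorem ζ_mem_center : ζ ∈ Subgroup.center SU3 := scalarCenter_mem_center 3 ω ω_pow_three _

/-- `ζ` as a matrix is `ω · 1`. [folklore] -/
theorem coe_ζ : ((ζ : SU3) : Matrix (Fin 3) (Fin 3) ℂ) = ω • (1 : Matrix (Fin 3) (Fin 3) ℂ) := rfl

/-- `tr(ζ g) = ω tr g`. [folklore] -/
theorem trace_ζ_mul (g : SU3) :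
    ((ζ * g : SU3) : Matrix (Fin 3) (Fin 3) ℂ).trace = ω * (g : Matrix (Fin 3) (Fin 3) ℂ).trace :=
  trace_scalarCenter_mul 3 ω ω_pow_three _ g

/-- `tr(ζ⁻¹ g) = ω² tr g`. [folklore] -/
theorem trace_ζ_inv_mul (g : SU3) :
    ((ζ⁻¹ * g : SU3) : Matrix (Fin 3) (Fin 3) ℂ).trace = ω ^ 2 * (g : Matrix (Fin 3) (Fin 3) ℂ).trace := by
  have h3 : (ζ : SU3) ^ 3 = 1 := by
    apply Subtype.ext
    change ((ζ : SU3) : Matrix (Fin 3) (Fin 3) ℂ) ^ 3 = 1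
    rw [coe_ζ, smul_pow, one_pow, ω_pow_three, one_smul]
  have hinv : (ζ : SU3)⁻¹ = ζ * ζ :=
    inv_eq_of_mul_eq_one_right (by simpa [pow_succ, mul_assoc] using h3)
  rw [hinv, mul_assoc, trace_ζ_mul, trace_ζ_mul, pow_two, mul_assoc]

variable {d L : ℕ}

/-- The single-link centre twist `U_{e₀} ↦ ζ U_{e₀}`. [folklore] -/
def edgeTwist (e₀ : Edge d L) (U : GaugeConfig d L SU3) : GaugeConfig d L SU3 :=
  Pi.mulSingle e₀ ζ * U

/-- The twist link by link. [folklore] -/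
theorem edgeTwist_apply (e₀ : Edge d L) (U : GaugeConfig d L SU3) (e : Edge d L) :
    edgeTwist e₀ U e = (if e = e₀ then ζ else 1) * U e := by
  simp [edgeTwist, Pi.mulSingle_apply]

/-- The twist factors are central. [folklore] -/
theorem twistFactor_mem_center (e₀ e : Edge d L) :
    (if e = e₀ then ζ else (1 : SU3)) ∈ Subgroup.center SU3 := by
  split_ifs
  exacts [ζ_mem_center, Subgroup.one_mem _]

/-- The plaquette holonomy after the single-link twist: a central factor comes out. [folklore] -/
theorem plaquetteHolonomy_edgeTwist (e₀ : Edge d L) (U : GaugeConfig d L SU3) (x : Site d L)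
    (i j : Fin d) :
    plaquetteHolonomy (edgeTwist e₀ U) x i j =
      (if (x, i) = e₀ then ζ else 1) * (if (x.shift i, j) = e₀ then ζ else 1) *
        (if (x.shift j, i) = e₀ then ζ else 1)⁻¹ * (if (x, j) = e₀ then ζ else 1)⁻¹ *
          plaquetteHolonomy U x i j := by
  simp only [plaquetteHolonomy, edgeTwist_apply]
  exact central_collect (twistFactor_mem_center e₀ _) (twistFactor_mem_center e₀ _)
    (twistFactor_mem_center e₀ _) _ _ _ _

/-- The four edges of the plaquette at `x` in the `(i, j)` plane. [folklore] -/
def plaqEdges (x : Site d L) (i j : Fin d) : Finset (Edge d L) :=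
  {(x, i), (x.shift i, j), (x.shift j, i), (x, j)}

/-- On a torus of side `> 1` the unit shift moves every site. [folklore] -/
theorem shift_ne_self [NeZero L] (hL : 1 < L) (x : Site d L) (k : Fin d) : x.shift k ≠ x := by
  haveI : Fact (1 < L) := ⟨hL⟩
  intro h
  have h1 : (x.shift k) k = x k := by rw [h]
  simp only [Site.shift, Pi.add_apply, Pi.single_eq_same, add_eq_left] at h1
  exact one_ne_zero h1

/-- If `e₀` is not an edge of the plaquette, the twist leaves its holonomy unchanged. [folklore] -/
theorem plaquetteHolonomy_edgeTwist_of_not_mem {e₀ : Edge d L} {x : Site d L} {i j : Fin d}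
    (h : e₀ ∉ plaqEdges x i j) (U : GaugeConfig d L SU3) :
    plaquetteHolonomy (edgeTwist e₀ U) x i j = plaquetteHolonomy U x i j := by
  simp only [plaqEdges, mem_insert, mem_singleton, not_or] at h
  obtain ⟨h1, h2, h3, h4⟩ := h
  rw [plaquetteHolonomy_edgeTwist, if_neg (Ne.symm h1), if_neg (Ne.symm h2), if_neg (Ne.symm h3),
    if_neg (Ne.symm h4)]
  simp

/-- If `e₀` IS an edge of a genuine plaquette (`i ≠ j`, `L > 1`), the twist multiplies the trace
of its holonomy by `ω` or `ω²`, in either case by a constant `≠ 1`. [folklore] -/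
theorem trace_plaquetteHolonomy_edgeTwist_of_mem [NeZero L] (hL : 1 < L) {e₀ : Edge d L}
    {x : Site d L} {i j : Fin d} (hij : i ≠ j) (h : e₀ ∈ plaqEdges x i j) :
    ∃ η : ℂ, η ≠ 1 ∧ ∀ U : GaugeConfig d L SU3,
      ((plaquetteHolonomy (edgeTwist e₀ U) x i j : SU3) : Matrix (Fin 3) (Fin 3) ℂ).trace =
        η * ((plaquetteHolonomy U x i j : SU3) : Matrix (Fin 3) (Fin 3) ℂ).trace := by
  have hsi := shift_ne_self hL x i
  have hsj := shift_ne_self hL x j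
  simp only [plaqEdges, mem_insert, mem_singleton] at h
  rcases h with rfl | rfl | rfl | rfl
  · refine ⟨ω, ω_ne_one, fun U => ?_⟩
    rw [plaquetteHolonomy_edgeTwist, if_pos rfl,
      if_neg (fun h => hij (Prod.ext_iff.1 h).2.symm),
      if_neg (fun h => hsj (Prod.ext_iff.1 h).1),
      if_neg (fun h => hij (Prod.ext_iff.1 h).2.symm)]
    simpa using trace_ζ_mul (plaquetteHolonomy U x i j)
  · refine ⟨ω, ω_ne_one, fun U => ?_⟩
    rw [plaquetteHolonomy_edgeTwist, if_neg (fun h => hij (Prod.ext_iff.1 h).2), if_pos rfl,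
      if_neg (fun h => hij (Prod.ext_iff.1 h).2),
      if_neg (fun h => hsi (Prod.ext_iff.1 h).1.symm)]
    simpa using trace_ζ_mul (plaquetteHolonomy U x i j)
  · refine ⟨ω ^ 2, ω_sq_ne_one, fun U => ?_⟩
    rw [plaquetteHolonomy_edgeTwist, if_neg (fun h => hsj (Prod.ext_iff.1 h).1.symm),
      if_neg (fun h => hij (Prod.ext_iff.1 h).2.symm), if_pos rfl,
      if_neg (fun h => hij (Prod.ext_iff.1 h).2.symm)]
    simpa using trace_ζ_inv_mul (plaquetteHolonomy U x i j)
  · refine ⟨ω ^ 2, ω_sq_ne_one, fun U => ?_⟩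
    rw [plaquetteHolonomy_edgeTwist, if_neg (fun h => hij (Prod.ext_iff.1 h).2),
      if_neg (fun h => hsi (Prod.ext_iff.1 h).1), if_neg (fun h => hij (Prod.ext_iff.1 h).2),
      if_pos rfl]
    simpa using trace_ζ_inv_mul (plaquetteHolonomy U x i j)


/-! ### Vanishing Haar integrals of plaquette traces -/

variable [NeZero L]

/-- The single-link centre twist as a measurable automorphism of configuration space. [folklore] -/
def edgeTwistEquiv (e₀ : Edge d L) : GaugeConfig d L SU3 ≃ᵐ GaugeConfig d L SU3 :=
  MeasurableEquiv.mulLeft (Pi.mulSingle e₀ ζ)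

omit [NeZero L] in
/-- `edgeTwistEquiv` acts as `edgeTwist`. [folklore] -/
@[simp] theorem edgeTwistEquiv_apply (e₀ : Edge d L) (U : GaugeConfig d L SU3) :
    edgeTwistEquiv e₀ U = edgeTwist e₀ U := rfl

/-- Product Haar measure is invariant under the single-link centre twist. [folklore] -/
theorem map_edgeTwist_pi_haar (e₀ : Edge d L) :
    (Measure.pi fun _ : Edge d L => haarProbability SU3).map (edgeTwistEquiv e₀) =
      Measure.pi fun _ : Edge d L => haarProbability SU3 := by
  change (Measure.pi fun _ : Edge d L => haarProbability SU3).map (fun U => Pi.mulSingle e₀ ζ * U) = _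
  exact map_mul_left_eq_self _ _

variable (d L) in
/-- The product Haar probability measure on the links of `(ℤ/L)^d` (the `β = 0` Wilson measure;
the crux's `μ`). [folklore] -/
abbrev haarLinks : Measure (GaugeConfig d L SU3) := Measure.pi fun _ : Edge d L => haarProbability SU3

/-- `haarLinks` is a probability measure. [folklore] -/
instance : IsProbabilityMeasure (haarLinks d L) := by
  unfold haarLinks; infer_instance

/-- The trace of the plaquette holonomy, `tr U_p ∈ ℂ`. [folklore] -/
def plaqTr (x : Site d L) (i j : Fin d) (U : GaugeConfig d L SU3) : ℂ :=
  ((plaquetteHolonomy U x i j : SU3) : Matrix (Fin 3) (Fin 3) ℂ).trace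

omit [NeZero L] in
/-- The plaquette holonomy is a continuous function of the links. [folklore] -/
theorem continuous_plaquetteHolonomy (x : Site d L) (i j : Fin d) :
    Continuous fun U : GaugeConfig d L SU3 => plaquetteHolonomy U x i j := by
  unfold plaquetteHolonomy; fun_prop

omit [NeZero L] in
/-- `tr U_p` is continuous in the links. [folklore] -/
theorem continuous_plaqTr (x : Site d L) (i j : Fin d) : Continuous (plaqTr x i j) := by
  unfold plaqTr
  exact (continuous_subtype_val.comp (continuous_plaquetteHolonomy x i j)).matrix_trace

/-- Continuous functions of the links are integrable for the product Haar probability measure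
(compact configuration space). [folklore] -/
theorem integrable_of_continuous {E : Type*} [NormedAddCommGroup E] {f : GaugeConfig d L SU3 → E}
    (hf : Continuous f) : Integrable f (haarLinks d L) :=
  hf.integrable_of_hasCompactSupport
    (IsCompact.of_isClosed_subset isCompact_univ (isClosed_tsupport _) (Set.subset_univ _))

/-- **`⟨tr U_p · Y⟩_{β=0} = 0`** for every edge `e₀` of the genuine plaquette `p` and every `Y`
invariant under the centre twist of `e₀`. [folklore] -/
theorem integral_plaqTr_mul_eq_zero (hL : 1 < L) {x : Site d L} {i j : Fin d} (hij : i ≠ j)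
    {e₀ : Edge d L} (he : e₀ ∈ plaqEdges x i j) (Y : GaugeConfig d L SU3 → ℂ)
    (hY : ∀ U, Y (edgeTwist e₀ U) = Y U) :
    ∫ U, plaqTr x i j U * Y U ∂(haarLinks d L) = 0 := by
  obtain ⟨η, hη, hcov⟩ := trace_plaquetteHolonomy_edgeTwist_of_mem hL hij he
  refine integral_eq_zero_of_covariant (edgeTwistEquiv e₀) (map_edgeTwist_pi_haar e₀) _ hη
    fun U => ?_
  rw [edgeTwistEquiv_apply, plaqTr, hcov U, hY U, plaqTr, mul_assoc]

/-- Real form: `⟨Re tr U_p · Y⟩_{β=0} = 0` for real continuous twist-invariant `Y`. [folklore] -/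
theorem integral_re_plaqTr_mul_eq_zero (hL : 1 < L) {x : Site d L} {i j : Fin d} (hij : i ≠ j)
    {e₀ : Edge d L} (he : e₀ ∈ plaqEdges x i j) (Y : GaugeConfig d L SU3 → ℝ)
    (hYc : Continuous Y) (hY : ∀ U, Y (edgeTwist e₀ U) = Y U) :
    ∫ U, (plaqTr x i j U).re * Y U ∂(haarLinks d L) = 0 := by
  have h0 := integral_plaqTr_mul_eq_zero hL hij he (fun U => (Y U : ℂ))
    (fun U => by rw [hY U])
  have hint : Integrable (fun U => plaqTr x i j U * (Y U : ℂ)) (haarLinks d L) :=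
    integrable_of_continuous ((continuous_plaqTr x i j).mul (continuous_ofReal.comp hYc))
  have hre : ∀ U, (plaqTr x i j U).re * Y U = RCLike.re (plaqTr x i j U * (Y U : ℂ)) := fun U => by
    simp
  simp_rw [hre]
  rw [integral_re hint, h0]
  simp

/-! ### The Wilson action density at a torus site: centred and uncorrelated at `β = 0` -/

/-- `O_x(U) = ∑_{i<j} Re tr U_{p_{ij}(x)}`, the Wilson action density at the torus site `x`. [folklore] -/
def siteAction (x : Site d L) (U : GaugeConfig d L SU3) : ℝ :=
  ∑ i : Fin d, ∑ j : Fin d, if i < j then (plaqTr x i j U).re else 0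

omit [NeZero L] in
/-- `O_x` is continuous in the links. [folklore] -/
theorem continuous_siteAction (x : Site d L) : Continuous (siteAction x) := by
  refine continuous_finsetSum _ fun i _ => continuous_finsetSum _ fun j _ => ?_
  split_ifs
  · exact continuous_re.comp (continuous_plaqTr x i j)
  · exact continuous_const

/-- `⟨O_x⟩_{β=0} = 0`. [folklore] -/
theorem integral_siteAction_eq_zero (hL : 1 < L) (x : Site d L) :
    ∫ U, siteAction x U ∂(haarLinks d L) = 0 := by
  unfold siteAction
  rw [integral_finsetSum _ fun i _ => ?_]
  · refine sum_eq_zero fun i _ => ?_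
    rw [integral_finsetSum _ fun j _ => ?_]
    · refine sum_eq_zero fun j _ => ?_
      split_ifs with hij
      · have h := integral_re_plaqTr_mul_eq_zero hL hij.ne
          (show ((x, i) : Edge d L) ∈ plaqEdges x i j by simp [plaqEdges]) (fun _ => (1 : ℝ))
          continuous_const (fun _ => rfl)
        simpa using h
      · simp
    · split_ifs
      · exact integrable_of_continuous (continuous_re.comp (continuous_plaqTr x i j))
      · exact integrable_const _
  · refine integrable_finsetSum _ fun j _ => ?_
    split_ifs
    · exact integrable_of_continuous (continuous_re.comp (continuous_plaqTr x i j))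
    · exact integrable_const _

omit [NeZero L] in
/-- Two plaquettes at DIFFERENT base points: the first has an edge avoiding the second
(explicitly: `(x, i)` unless it is an edge of the second, else `(x, j)`). [folklore] -/
theorem exists_edge_not_mem (hL : 1 < L) {x y : Site d L} (hxy : x ≠ y) {i j i' j' : Fin d}
    (hij : i ≠ j) (hij' : i' < j') :
    ∃ e₀ ∈ plaqEdges x i j, e₀ ∉ plaqEdges y i' j' := by
  have hsingle : ∀ {a b : Fin d}, y.shift a = y.shift b → a = b := fun {a b} h => by
    by_contra hab
    haveI : Fact (1 < L) := ⟨hL⟩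
    have h1 := congrFun h a
    simp only [Site.shift, Pi.add_apply, Pi.single_eq_same, Pi.single_eq_of_ne hab,
      add_zero, add_eq_left] at h1
    exact one_ne_zero h1
  by_cases h1 : (x, i) ∈ plaqEdges y i' j'
  · refine ⟨(x, j), by simp [plaqEdges], fun h2 => ?_⟩
    simp only [plaqEdges, mem_insert, mem_singleton, Prod.mk.injEq] at h1 h2
    rcases h1 with ⟨rfl, -⟩ | ⟨hx1, rfl⟩ | ⟨hx1, rfl⟩ | ⟨rfl, -⟩
    · exact hxy rfl
    · rcases h2 with ⟨h, -⟩ | ⟨-, h⟩ | ⟨hx2, rfl⟩ | ⟨h, -⟩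
      · exact hxy h
      · exact hij h.symm
      · exact (lt_irrefl _) (hsingle (hx1.symm.trans hx2) ▸ hij')
      · exact hxy h
    · rcases h2 with ⟨h, -⟩ | ⟨hx2, rfl⟩ | ⟨-, h⟩ | ⟨h, -⟩
      · exact hxy h
      · exact (lt_irrefl _) (hsingle (hx2.symm.trans hx1) ▸ hij')
      · exact hij h.symm
      · exact hxy h
    · exact hxy rfl
  · exact ⟨(x, i), by simp [plaqEdges], h1⟩

/-- **Distinct sites are uncorrelated at `β = 0`**: `⟨O_x O_y⟩ = 0` for `x ≠ y`. [folklore] -/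
theorem integral_siteAction_mul_eq_zero (hL : 1 < L) {x y : Site d L} (hxy : x ≠ y) :
    ∫ U, siteAction x U * siteAction y U ∂(haarLinks d L) = 0 := by
  -- expand `O_x` and pull the sums out
  have hterm : ∀ i j : Fin d, i < j →
      ∫ U, (plaqTr x i j U).re * siteAction y U ∂(haarLinks d L) = 0 := by
    intro i j hij
    unfold siteAction
    simp_rw [mul_sum]
    rw [integral_finsetSum _ fun i' _ => ?_]
    · refine sum_eq_zero fun i' _ => ?_
      rw [integral_finsetSum _ fun j' _ => ?_]
      · refine sum_eq_zero fun j' _ => ?_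
        split_ifs with hij'
        · obtain ⟨e₀, he₀, hne⟩ := exists_edge_not_mem hL hxy hij.ne hij'
          exact integral_re_plaqTr_mul_eq_zero hL hij.ne he₀ _
            (continuous_re.comp (continuous_plaqTr y i' j'))
            (fun U => by simp only [plaqTr, plaquetteHolonomy_edgeTwist_of_not_mem hne])
        · simp
      · split_ifs
        · exact integrable_of_continuous
            ((continuous_re.comp (continuous_plaqTr x i j)).mul
              (continuous_re.comp (continuous_plaqTr y i' j')))
        · simp
    · refine integrable_finsetSum _ fun j' _ => ?_
      split_ifs
      · exact integrable_of_continuous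
          ((continuous_re.comp (continuous_plaqTr x i j)).mul
            (continuous_re.comp (continuous_plaqTr y i' j')))
      · simp
  conv_lhs => arg 2; ext U; rw [siteAction, sum_mul]
  rw [integral_finsetSum _ fun i _ => ?_]
  · refine sum_eq_zero fun i _ => ?_
    simp_rw [sum_mul]
    rw [integral_finsetSum _ fun j _ => ?_]
    · refine sum_eq_zero fun j _ => ?_
      split_ifs with hij
      · exact hterm i j hij
      · simp
    · split_ifs
      · exact integrable_of_continuous
          ((continuous_re.comp (continuous_plaqTr x i j)).mul (continuous_siteAction y))
      · simp
  · simp_rw [sum_mul]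
    refine integrable_finsetSum _ fun j _ => ?_
    split_ifs
    · exact integrable_of_continuous
        ((continuous_re.comp (continuous_plaqTr x i j)).mul (continuous_siteAction y))
    · simp

end Summit.QuantumFields.QCD.Theorems.RobustYangMillsRG.Negative

end
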